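import Summits.FinalStateConjecture.FinalStateConjecture.Theorems.EIHFluxBalanceInertialRecessionVirialClassPrep
import Summits.FinalStateConjecture.FinalStateConjecture.Theorems.EIHFluxBalanceInertialRecessionVirialFrozen

/-!
# Route EIHFluxBalance — crux `InertialRecession`, abstract endgame for general `N`:
# a SLOW pair in pair mode is frozen (toward LEMMA SPLIT, block L5b)

Helper file for the crux `stmt-FinalStateConjecture-10166` (virial route, `work/split/PLAN.md` §"L5 refined"). Mathlib-only.
* `cluster_charge_frozen₂` — `cluster_charge_frozen` with the sharp exclusion: non-members only need to stay beyond `3ηs/8`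
  (`= 3R/2` for the window radius `R = ηs/4`);
* `pair_mode_frozen` — two bodies `a, c` in PAIR MODE on `[p₁, p₂]` (`d_ac ≤ θs/4`, every other body beyond `θs` from `a`,
  window `(ξₐ, θs/2)` admissible): the pair energy, momentum and internal energy `K_ac` are frozen up to
  `Bd = |C|·2(θ/2)^{-3/2}p₁^{-1/2} + ζ(p₁) + ζ(s)`, and consequently the velocity of `a` stays within
  `√(2Γ³(K_ac(p₁) + 4Bd)/M_a) + 18Bd/(M_a + M_c)` of the frozen cold velocity `V̂_ac(p₁)`
  (`mass_mul_norm_sub_coldVelocity_sq_le'`, `norm_coldVelocity_sub_le`): a SLOW pair (small `K_ac(p₁)`) has frozen member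
  velocities pointwise.
-/

noncomputable section

open Finset Filter Topology MeasureTheory intervalIntegral

namespace Summit.FinalStateConjecture.FinalStateConjecture.Theorems.SublinearIsFree.Virial

open Literature.Geometry.Lorentzian

variable {N : ℕ}

/-- **Frozen charges of an isolated cluster, sharp exclusion `3ηs/8`.** [folklore] -/
theorem cluster_charge_frozen₂ (M : Fin N → ℝ) (ξ v : Fin N → ℝ → E3) (κ : ℝ) (P : ℝ → E3 → ℝ → Fin 4 → ℝ)
    (ρ : ℝ → ℝ) (C T T' T₀ : ℝ) (ζ : ℝ → ℝ)
    (hWL : ∀ (t₁ t₂ : ℝ) (c : ℝ → E3) (R : ℝ → ℝ), T ≤ t₁ → t₁ ≤ t₂ →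
      (∀ s ∈ Set.Icc t₁ t₂, ∀ s' ∈ Set.Icc t₁ t₂, ‖c s - c s'‖ ≤ 2 * |s - s'| ∧ |R s - R s'| ≤ 2 * |s - s'|) →
      (∀ s ∈ Set.Icc t₁ t₂, ρ s ≤ (1 / 2) * R s ∧ ‖c s‖ + R s ≤ (κ + κ ^ 2) / 2 * s ∧
        ∀ j, ‖ξ j s - c s‖ ≤ (1 - 1 / 2) * R s ∨ (1 + 1 / 2) * R s ≤ ‖ξ j s - c s‖) →
      ∀ μ : Fin 4, |P t₂ (c t₂) (R t₂) μ - P t₁ (c t₁) (R t₁) μ| ≤ C * ∫ s in t₁..t₂, (R s ^ (3 / 2 : ℝ))⁻¹)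
    (hID : ∀ (t : ℝ) (c : E3) (R : ℝ) (A : Finset (Fin N)), T' ≤ t → ρ t ≤ (1 / 2) * R →
      ‖c‖ + R ≤ (κ + κ ^ 2) / 2 * t →
      (∀ j, ‖ξ j t - c‖ ≤ (1 - 1 / 2) * R ∨ (1 + 1 / 2) * R ≤ ‖ξ j t - c‖) →
      (∀ j, j ∈ A ↔ ‖ξ j t - c‖ ≤ (1 - 1 / 2) * R) →
      |P t c R 0 - ∑ j ∈ A, M j * (√(1 - ‖v j t‖ ^ 2))⁻¹| ≤ ζ t ∧
      ∀ k : Fin 3, |P t c R k.succ - ∑ j ∈ A, M j * (√(1 - ‖v j t‖ ^ 2))⁻¹ * v j t k| ≤ ζ t)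
    (hdiff : ∀ i, Differentiable ℝ (ξ i)) (hspeed : ∀ i s, T₀ ≤ s → ‖deriv (ξ i) s‖ ≤ 2)
    {A : Finset (Fin N)} {a : Fin N}
    {t₁ t₂ η : ℝ} (hη : 0 < η) (hη8 : η ≤ 8) (hT : T ≤ t₁) (hT' : T' ≤ t₁) (hT₀ : T₀ ≤ t₁) (ht₁ : 0 < t₁)
    (h12 : t₁ ≤ t₂) (hρ : ∀ s ∈ Set.Icc t₁ t₂, ρ s ≤ η * s / 8)
    (hcap : ∀ s ∈ Set.Icc t₁ t₂, ‖ξ a s‖ + η / 4 * s ≤ (κ + κ ^ 2) / 2 * s)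
    (hmem : ∀ s ∈ Set.Icc t₁ t₂, ∀ i ∈ A, ‖ξ i s - ξ a s‖ ≤ η * s / 8)
    (hnon : ∀ s ∈ Set.Icc t₁ t₂, ∀ j ∉ A, 3 * η * s / 8 ≤ ‖ξ j s - ξ a s‖) :
    |∑ j ∈ A, M j * (√(1 - ‖v j t₂‖ ^ 2))⁻¹ - ∑ j ∈ A, M j * (√(1 - ‖v j t₁‖ ^ 2))⁻¹| ≤
        |C| * (2 * ((η / 4) ^ (3 / 2 : ℝ))⁻¹ * (t₁ ^ (1 / 2 : ℝ))⁻¹) + ζ t₁ + ζ t₂ ∧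
      ‖∑ j ∈ A, (M j * (√(1 - ‖v j t₂‖ ^ 2))⁻¹) • v j t₂ - ∑ j ∈ A, (M j * (√(1 - ‖v j t₁‖ ^ 2))⁻¹) • v j t₁‖ ≤
        3 * (|C| * (2 * ((η / 4) ^ (3 / 2 : ℝ))⁻¹ * (t₁ ^ (1 / 2 : ℝ))⁻¹) + ζ t₁ + ζ t₂) ∧
      |(∑ j ∈ A, M j * (√(1 - ‖v j t₂‖ ^ 2))⁻¹ -
          √((∑ i ∈ A, M i) ^ 2 + ‖∑ j ∈ A, (M j * (√(1 - ‖v j t₂‖ ^ 2))⁻¹) • v j t₂‖ ^ 2)) -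
        (∑ j ∈ A, M j * (√(1 - ‖v j t₁‖ ^ 2))⁻¹ -
          √((∑ i ∈ A, M i) ^ 2 + ‖∑ j ∈ A, (M j * (√(1 - ‖v j t₁‖ ^ 2))⁻¹) • v j t₁‖ ^ 2))| ≤
        4 * (|C| * (2 * ((η / 4) ^ (3 / 2 : ℝ))⁻¹ * (t₁ ^ (1 / 2 : ℝ))⁻¹) + ζ t₁ + ζ t₂) := by
  classical
  have hη4 : 0 < η / 4 := by positivity
  have hinc := Oracle.increment_of_windowPath M ξ v κ P ρ C T T' T₀ ζ hWL hID hdiff hspeed (A := A) (a := a)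
    (t₁ := t₁) (t₂ := t₂) (R := fun s ↦ η / 4 * s) hT hT' hT₀ h12
    (fun s _ s' _ ↦ by
      show |η / 4 * s - η / 4 * s'| ≤ 2 * |s - s'|
      rw [← mul_sub, abs_mul, abs_of_pos hη4]
      exact mul_le_mul_of_nonneg_right (by linarith) (abs_nonneg _))
    (fun s hs ↦ mul_pos hη4 (ht₁.trans_le hs.1))
    (fun s hs ↦ by have := hρ s hs; show ρ s ≤ η / 4 * s / 2; linarith)
    hcap
    (fun s hs i hi ↦ by have := hmem s hs i hi; show ‖ξ i s - ξ a s‖ ≤ η / 4 * s / 2; linarith)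
    (fun s hs j hj ↦ by have h := hnon s hs j hj; show 3 * (η / 4 * s) / 2 ≤ ‖ξ j s - ξ a s‖; linarith)
  have hCle := mul_integral_inv_rpow_le_abs (C := C) hη4 ht₁ h12
  set Bd : ℝ := |C| * (2 * ((η / 4) ^ (3 / 2 : ℝ))⁻¹ * (t₁ ^ (1 / 2 : ℝ))⁻¹) + ζ t₁ + ζ t₂ with hBd
  have hE : |∑ j ∈ A, M j * (√(1 - ‖v j t₂‖ ^ 2))⁻¹ - ∑ j ∈ A, M j * (√(1 - ‖v j t₁‖ ^ 2))⁻¹| ≤ Bd :=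
    hinc.1.trans (by rw [hBd]; linarith)
  have hPk : ∀ k : Fin 3, |∑ j ∈ A, M j * (√(1 - ‖v j t₂‖ ^ 2))⁻¹ * v j t₂ k -
      ∑ j ∈ A, M j * (√(1 - ‖v j t₁‖ ^ 2))⁻¹ * v j t₁ k| ≤ Bd := fun k ↦ (hinc.2 k).trans (by rw [hBd]; linarith)
  have hP : ‖∑ j ∈ A, (M j * (√(1 - ‖v j t₂‖ ^ 2))⁻¹) • v j t₂ - ∑ j ∈ A, (M j * (√(1 - ‖v j t₁‖ ^ 2))⁻¹) • v j t₁‖ ≤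
      3 * Bd := Oracle.norm_momentum_sub_le_of_components A M (fun j ↦ v j t₁) (fun j ↦ v j t₂) hPk
  refine ⟨hE, hP, ?_⟩
  have hK := abs_internalEnergy_sub_le (∑ i ∈ A, M i) (∑ j ∈ A, M j * (√(1 - ‖v j t₂‖ ^ 2))⁻¹)
    (∑ j ∈ A, M j * (√(1 - ‖v j t₁‖ ^ 2))⁻¹) (∑ j ∈ A, (M j * (√(1 - ‖v j t₂‖ ^ 2))⁻¹) • v j t₂)
    (∑ j ∈ A, (M j * (√(1 - ‖v j t₁‖ ^ 2))⁻¹) • v j t₁)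
  linarith

/-- **A slow pair in pair mode is frozen** (see the module docstring). [folklore] -/
theorem pair_mode_frozen (M : Fin N → ℝ) (ξ v : Fin N → ℝ → E3) (κ : ℝ) (P : ℝ → E3 → ℝ → Fin 4 → ℝ)
    (ρ : ℝ → ℝ) (C T T' T₀ : ℝ) (ζ : ℝ → ℝ)
    (hWL : ∀ (t₁ t₂ : ℝ) (c : ℝ → E3) (R : ℝ → ℝ), T ≤ t₁ → t₁ ≤ t₂ →
      (∀ s ∈ Set.Icc t₁ t₂, ∀ s' ∈ Set.Icc t₁ t₂, ‖c s - c s'‖ ≤ 2 * |s - s'| ∧ |R s - R s'| ≤ 2 * |s - s'|) →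
      (∀ s ∈ Set.Icc t₁ t₂, ρ s ≤ (1 / 2) * R s ∧ ‖c s‖ + R s ≤ (κ + κ ^ 2) / 2 * s ∧
        ∀ j, ‖ξ j s - c s‖ ≤ (1 - 1 / 2) * R s ∨ (1 + 1 / 2) * R s ≤ ‖ξ j s - c s‖) →
      ∀ μ : Fin 4, |P t₂ (c t₂) (R t₂) μ - P t₁ (c t₁) (R t₁) μ| ≤ C * ∫ s in t₁..t₂, (R s ^ (3 / 2 : ℝ))⁻¹)
    (hID : ∀ (t : ℝ) (c : E3) (R : ℝ) (A : Finset (Fin N)), T' ≤ t → ρ t ≤ (1 / 2) * R →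
      ‖c‖ + R ≤ (κ + κ ^ 2) / 2 * t →
      (∀ j, ‖ξ j t - c‖ ≤ (1 - 1 / 2) * R ∨ (1 + 1 / 2) * R ≤ ‖ξ j t - c‖) →
      (∀ j, j ∈ A ↔ ‖ξ j t - c‖ ≤ (1 - 1 / 2) * R) →
      |P t c R 0 - ∑ j ∈ A, M j * (√(1 - ‖v j t‖ ^ 2))⁻¹| ≤ ζ t ∧
      ∀ k : Fin 3, |P t c R k.succ - ∑ j ∈ A, M j * (√(1 - ‖v j t‖ ^ 2))⁻¹ * v j t k| ≤ ζ t)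
    (hdiff : ∀ i, Differentiable ℝ (ξ i)) (hspeed : ∀ i s, T₀ ≤ s → ‖deriv (ξ i) s‖ ≤ 2)
    (hM : ∀ i, 0 < M i) {k : ℝ} (hk0 : 0 ≤ k) (hk1 : k < 1) (hvk : ∀ i t, ‖v i t‖ ≤ k)
    {a c : Fin N}
    {p₁ p₂ θ : ℝ} (hθ : 0 < θ) (hθ4 : θ ≤ 4) (hT : T ≤ p₁) (hT' : T' ≤ p₁) (hT₀ : T₀ ≤ p₁) (hp₁ : 0 < p₁)
    (hρ : ∀ s ∈ Set.Icc p₁ p₂, ρ s ≤ θ * s / 4)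
    (hcap : ∀ s ∈ Set.Icc p₁ p₂, ‖ξ a s‖ + θ / 2 * s ≤ (κ + κ ^ 2) / 2 * s)
    (hmem : ∀ s ∈ Set.Icc p₁ p₂, ‖ξ c s - ξ a s‖ ≤ θ * s / 4)
    (hnon : ∀ s ∈ Set.Icc p₁ p₂, ∀ y, y ≠ a → y ≠ c → θ * s ≤ ‖ξ y s - ξ a s‖) :
    ∀ s ∈ Set.Icc p₁ p₂,
      (∑ j ∈ ({a, c} : Finset (Fin N)), M j * (√(1 - ‖v j s‖ ^ 2))⁻¹ -
          √((∑ i ∈ ({a, c} : Finset (Fin N)), M i) ^ 2 +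
            ‖∑ j ∈ ({a, c} : Finset (Fin N)), (M j * (√(1 - ‖v j s‖ ^ 2))⁻¹) • v j s‖ ^ 2) ≤
        (∑ j ∈ ({a, c} : Finset (Fin N)), M j * (√(1 - ‖v j p₁‖ ^ 2))⁻¹ -
          √((∑ i ∈ ({a, c} : Finset (Fin N)), M i) ^ 2 +
            ‖∑ j ∈ ({a, c} : Finset (Fin N)), (M j * (√(1 - ‖v j p₁‖ ^ 2))⁻¹) • v j p₁‖ ^ 2)) +
        4 * (|C| * (2 * ((2 * θ / 4) ^ (3 / 2 : ℝ))⁻¹ * (p₁ ^ (1 / 2 : ℝ))⁻¹) + ζ p₁ + ζ s)) ∧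
      ‖v a s - (√((∑ i ∈ ({a, c} : Finset (Fin N)), M i) ^ 2 +
          ‖∑ j ∈ ({a, c} : Finset (Fin N)), (M j * (√(1 - ‖v j p₁‖ ^ 2))⁻¹) • v j p₁‖ ^ 2))⁻¹ •
          ∑ j ∈ ({a, c} : Finset (Fin N)), (M j * (√(1 - ‖v j p₁‖ ^ 2))⁻¹) • v j p₁‖ ≤
        √(2 * ((√(1 - k ^ 2))⁻¹) ^ 3 *
            (∑ j ∈ ({a, c} : Finset (Fin N)), M j * (√(1 - ‖v j s‖ ^ 2))⁻¹ -
              √((∑ i ∈ ({a, c} : Finset (Fin N)), M i) ^ 2 +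
                ‖∑ j ∈ ({a, c} : Finset (Fin N)), (M j * (√(1 - ‖v j s‖ ^ 2))⁻¹) • v j s‖ ^ 2)) / M a) +
          18 * (|C| * (2 * ((2 * θ / 4) ^ (3 / 2 : ℝ))⁻¹ * (p₁ ^ (1 / 2 : ℝ))⁻¹) + ζ p₁ + ζ s) /
            (∑ i ∈ ({a, c} : Finset (Fin N)), M i) := by
  classical
  intro s hs
  have hsub : Set.Icc p₁ s ⊆ Set.Icc p₁ p₂ := Set.Icc_subset_Icc_right hs.2
  -- pair mode: the cluster `{a, c}` with anchor `a`, `η = 2θ`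
  have hfr := cluster_charge_frozen₂ M ξ v κ P ρ C T T' T₀ ζ hWL hID hdiff hspeed (A := ({a, c} : Finset (Fin N)))
    (a := a) (η := 2 * θ) (by positivity) (by linarith) hT hT' hT₀ hp₁ hs.1
    (fun s' hs' ↦ by have := hρ s' (hsub hs'); linarith)
    (fun s' hs' ↦ by have := hcap s' (hsub hs'); linarith)
    (fun s' hs' i hi ↦ by
      rcases Finset.mem_insert.mp hi with h | h
      · rw [h, sub_self, norm_zero]; have : 0 < s' := hp₁.trans_le hs'.1; positivity
      · rw [Finset.mem_singleton.mp h]; have := hmem s' (hsub hs'); linarith)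
    (fun s' hs' j hj ↦ by
      have hja : j ≠ a := fun h ↦ hj (by simp [h])
      have hjc : j ≠ c := fun h ↦ hj (by simp [h])
      have h1 := hnon s' (hsub hs') j hja hjc
      have h2 : 0 ≤ θ * s' := mul_nonneg hθ.le (hp₁.trans_le hs'.1).le
      linarith)
  obtain ⟨-, hP, hK⟩ := hfr
  set Bd : ℝ := |C| * (2 * ((2 * θ / 4) ^ (3 / 2 : ℝ))⁻¹ * (p₁ ^ (1 / 2 : ℝ))⁻¹) + ζ p₁ + ζ s with hBd
  have hK' := (abs_le.mp hK).2
  refine ⟨by linarith, ?_⟩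
  -- the member velocity is close to the cold velocity at time `s`
  have hMs : ∀ i ∈ ({a, c} : Finset (Fin N)), 0 < M i := fun i _ ↦ hM i
  have ha : a ∈ ({a, c} : Finset (Fin N)) := Finset.mem_insert_self _ _
  have hMB : 0 < ∑ i ∈ ({a, c} : Finset (Fin N)), M i := Finset.sum_pos hMs ⟨a, ha⟩
  have hcold := mass_mul_norm_sub_coldVelocity_sq_le' ({a, c} : Finset (Fin N)) M (fun j ↦ v j s) hMs hk0 hk1
    (fun i _ ↦ hvk i s) ha
  set Ks : ℝ := ∑ j ∈ ({a, c} : Finset (Fin N)), M j * (√(1 - ‖v j s‖ ^ 2))⁻¹ -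
    √((∑ i ∈ ({a, c} : Finset (Fin N)), M i) ^ 2 +
      ‖∑ j ∈ ({a, c} : Finset (Fin N)), (M j * (√(1 - ‖v j s‖ ^ 2))⁻¹) • v j s‖ ^ 2) with hKs
  set Vs : E3 := (√((∑ i ∈ ({a, c} : Finset (Fin N)), M i) ^ 2 +
      ‖∑ j ∈ ({a, c} : Finset (Fin N)), (M j * (√(1 - ‖v j s‖ ^ 2))⁻¹) • v j s‖ ^ 2))⁻¹ •
      ∑ j ∈ ({a, c} : Finset (Fin N)), (M j * (√(1 - ‖v j s‖ ^ 2))⁻¹) • v j s with hVs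
  set Vp : E3 := (√((∑ i ∈ ({a, c} : Finset (Fin N)), M i) ^ 2 +
      ‖∑ j ∈ ({a, c} : Finset (Fin N)), (M j * (√(1 - ‖v j p₁‖ ^ 2))⁻¹) • v j p₁‖ ^ 2))⁻¹ •
      ∑ j ∈ ({a, c} : Finset (Fin N)), (M j * (√(1 - ‖v j p₁‖ ^ 2))⁻¹) • v j p₁ with hVp
  have hMa := hM a
  have hΓ0 : 0 < (√(1 - k ^ 2))⁻¹ := inv_pos.mpr (Real.sqrt_pos.mpr (by nlinarith))
  have h1 : ‖v a s - Vs‖ ≤ √(2 * ((√(1 - k ^ 2))⁻¹) ^ 3 * Ks / M a) := by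
    have hsq : ‖v a s - Vs‖ ^ 2 ≤ 2 * ((√(1 - k ^ 2))⁻¹) ^ 3 * Ks / M a := by
      rw [le_div_iff₀ hMa]
      have : M a * ‖v a s - Vs‖ ^ 2 ≤ 2 * ((√(1 - k ^ 2))⁻¹) ^ 3 * Ks := hcold
      linarith
    calc ‖v a s - Vs‖ = √(‖v a s - Vs‖ ^ 2) := (Real.sqrt_sq (norm_nonneg _)).symm
      _ ≤ √(2 * ((√(1 - k ^ 2))⁻¹) ^ 3 * Ks / M a) := Real.sqrt_le_sqrt hsq
  have h2 : ‖Vs - Vp‖ ≤ 18 * Bd / (∑ i ∈ ({a, c} : Finset (Fin N)), M i) := by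
    have h := norm_coldVelocity_sub_le hMB (∑ j ∈ ({a, c} : Finset (Fin N)), (M j * (√(1 - ‖v j s‖ ^ 2))⁻¹) • v j s)
      (∑ j ∈ ({a, c} : Finset (Fin N)), (M j * (√(1 - ‖v j p₁‖ ^ 2))⁻¹) • v j p₁)
    refine h.trans ?_
    rw [div_le_div_iff_of_pos_right hMB]
    linarith
  calc ‖v a s - Vp‖ = ‖(v a s - Vs) + (Vs - Vp)‖ := by congr 1; abel
    _ ≤ ‖v a s - Vs‖ + ‖Vs - Vp‖ := norm_add_le _ _
    _ ≤ _ := add_le_add h1 h2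

/-- Registered one-line helper of this file: membership of the anchor in the pair `{a, c}`. [folklore] -/
theorem mem_pair_self : ∀ {N : ℕ} (a c : Fin N), a ∈ ({a, c} : Finset (Fin N)) :=
  fun a _ ↦ Finset.mem_insert_self a _

end Summit.FinalStateConjecture.FinalStateConjecture.Theorems.SublinearIsFree.Virial

end
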